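/-
Copyright: the b2b-balaban cell (near-miss cell 7), T⁴-continuum fan-out; row NE7b ROUND-2 swarm, seat
t4-ne7b-formalise-leaf-02 (gen 6) — supplier piece for the S6g′ INSTANCE's T3b «injection» (owner's rulings
R-OWNER-22-23∕-24; booking «T3b-GLUE := leaf-02 g6», journal l.12945): the instance's zone `zoneP` reads the births
and the root cell only.  A supplier module consumed BY NAME; not a claim of T3b.  Released under the licence of the surrounding project.
-/
import Summits.QuantumFields.BalabanUV.T4Continuum.Support.HistoryJoinsPlacedZone
import Summits.QuantumFields.BalabanUV.T4Continuum.Support.HistoryJoinsRearrange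

/-!
# The instance's zone `zoneP` is BIRTHS-ONLY: the hypothesis `hzone` of `HistoryJoinsRearrange` discharged

Summits-side support leaf of the T⁴-continuum cell (rung (B)+1 on a FINITE torus only; NOT infinite volume, NOT the
mass gap, NOT the Clay statement; NOT a proof of the spine estimate NE7b).  Row NE7b, route «COUNT», row S6g′
INSTANCE, piece T3b.  [folklore] finite bookkeeping; nothing is quoted from print, nothing printed is asserted, no
`[cite:]` tag, no definition, no `Prop` fact minted.  Imports leaf-05 g3's `HistoryJoinsPlacedZone` (p218357: `zoneP`,
`OK`, `regOf`) and part 2″ `HistoryJoinsRearrange` (`bread`, `exists_rearranged_cadm`).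

WHAT.  §1 two congruences over a finset read through two maps with the same image (`forall_congr_of_image_eq`,
`biUnion_congr_of_image_eq`) and THE BRIDGE **`image_births_addrTag`**: the (label, datum) pairs read off the
address-TAGGED births of `addrTag a Z` under a placement `P` are part 2″'s reading `bread c₀ Z (rel c₀ a P)` (as a
finset) — `image_births_addrTag_nil` at the empty prefix.  §2 **`ok_congr`**,
**`coreZoneD_regOf_congr`**, **`zoneP_congr`**: two placements of `Z` with the same births' reading and the same
root value have the same `OK`, the same core zone and the same `zoneP` at every step — i.e. the displayed hypothesis
`hzone` of `HistoryJoinsRearrange.exists_rearranged_cadm` HOLDS for the instance's zone (**`hzone_zoneP`**, stated in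
that hypothesis' exact shape).

HONEST SCOPE.  Bookkeeping on the instance's own definitions; the other displayed hypothesis of the recursion
(`Function.Injective ρ`) is the instance seat's choice of `ρ`; `PhysTop` from realised contact, the template factor
and the injectivity on the slot's occupants are T3b proper (its holder's), NOT here.  Nothing of H3∕(B)∕BetaPertH
touched; `BirthShapeNodup`∕`resum` NOT retired by this file; NE7b NOT proved; spine 0∕9.  HONEST DEPENDENCY (cell):
continuum YM on T⁴ ⇐ BetaPertH ∧ nine spine estimates (0/9 proved); BetaPertH ⇐ (D1) ∧ (D4) ∧ CAP+tail; G-an2-4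
gates asym, D1 and NE2/3/4.  This file changes none of it.
-/

open Finset
open Literature.MathematicalPhysics.QuantumFieldTheory.Balaban1983to89
open Literature.MathematicalPhysics.QuantumFieldTheory.Balaban1983to89.B13ScaleTransfer (Pt FaceConnected)
open T4PersistenceDictionary T4PartnerMultiplicity T4BranchingRecordsGas
open Summit.QuantumFields.BalabanUV.T4Continuum.PlacementSkeleton
open Summit.QuantumFields.BalabanUV.T4Continuum.ZoneTorus
open Summit.QuantumFields.BalabanUV.T4Continuum.HistoryZones
open Summit.QuantumFields.BalabanUV.T4Continuum.HistoryZoneMass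
open Summit.QuantumFields.BalabanUV.T4Continuum.HistoryJoins
open Summit.QuantumFields.BalabanUV.T4Continuum.HistoryJoinsAdm
open Summit.QuantumFields.BalabanUV.T4Continuum.HistoryJoinsTag
open Summit.QuantumFields.BalabanUV.T4Continuum.HistoryRegionTemplates
open Summit.QuantumFields.BalabanUV.T4Continuum.HistoryJoinsTemplates
open Summit.QuantumFields.BalabanUV.T4Continuum.HistoryJoinsPlacedZone
open Summit.QuantumFields.BalabanUV.T4Continuum.HistoryJoinsGlue
open Summit.QuantumFields.BalabanUV.T4Continuum.HistoryJoinsRearrange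

namespace Summit.QuantumFields.BalabanUV.T4Continuum.HistoryJoinsPlacedZoneRead

noncomputable section

open scoped Classical

/-! ## §1 Reading a finset through two maps with the same image; the bridge to the tagged births -/

section Image

variable {α β : Type*} [DecidableEq β] {s : Finset α} {f f' : α → β}

/-- a property of the values is read off the image [folklore] -/
theorem forall_congr_of_image_eq (h : s.image f = s.image f') (Q : β → Prop) :
    (∀ a ∈ s, Q (f a)) ↔ ∀ a ∈ s, Q (f' a) := by
  constructor
  · intro H a ha
    obtain ⟨b, hb, hfb⟩ := Finset.mem_image.1 (h ▸ Finset.mem_image_of_mem f' ha : f' a ∈ s.image f)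
    rw [← hfb]
    exact H b hb
  · intro H a ha
    obtain ⟨b, hb, hfb⟩ := Finset.mem_image.1 (h.symm ▸ Finset.mem_image_of_mem f ha : f a ∈ s.image f')
    rw [← hfb]
    exact H b hb

/-- a union over the values is read off the image [folklore] -/
theorem biUnion_congr_of_image_eq {δ : Type*} [DecidableEq δ] (h : s.image f = s.image f') (G : β → Finset δ) :
    (s.biUnion fun a => G (f a)) = s.biUnion fun a => G (f' a) := by
  rw [← Finset.image_biUnion (f := f) (t := G), h, Finset.image_biUnion]

end Image

section Bridge

variable {ε γ : Type*} [DecidableEq ε] [DecidableEq γ] {D : ℕ} (c₀ : γ)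

/-- **THE BRIDGE**: the (label, datum) pairs read off the tagged births of `addrTag a Z` under `P` are the births'
reading `bread c₀ Z (rel c₀ a P)`, as a finset. [folklore] -/
theorem image_births_addrTag : ∀ (a : List Bool) (Z : Gen ε) (P : Addr D → γ),
    (births (addrTag a Z)).image (fun ab => (ab.2, evalA c₀ P ab.1)) =
      (bread c₀ Z (rel c₀ a P)).toFinset
  | a, Gen.born b j, P => by
      simp [evalA_rel]
  | a, Gen.renew G e h, P => by
      simpa using image_births_addrTag a G P
  | a, Gen.merge X Y e, P => by
      rw [addrTag_merge, births_merge, image_union, image_births_addrTag _ X P, image_births_addrTag _ Y P,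
        bread_merge, Multiset.toFinset_add, ← rel_append, ← rel_append]

/-- … at the empty prefix [folklore] -/
theorem image_births_addrTag_nil (Z : Gen ε) (P : Addr D → γ) :
    (births (addrTag [] Z)).image (fun ab => (ab.2, evalA c₀ P ab.1)) =
      (bread c₀ Z P).toFinset := by
  simpa using image_births_addrTag c₀ [] Z P

/-- hence two placements with the same births' reading read the same (label, datum) pairs off the tagged births
[folklore] -/
theorem image_births_addrTag_eq_of_bread_eq {Z : Gen ε} {P P' : Addr D → γ} (h : bread c₀ Z P = bread c₀ Z P') :
    (births (addrTag [] Z)).image (fun ab => (ab.2, evalA c₀ P ab.1)) =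
      (births (addrTag [] Z)).image (fun ab => (ab.2, evalA c₀ P' ab.1)) := by
  rw [image_births_addrTag_nil, image_births_addrTag_nil, h]

end Bridge

/-! ## §2 The instance's zone reads the births and the root cell only -/

section Zone

variable {d n L K D M : ℕ} {lv : ℕ → ℕ} {c : ℕ} {c₀ : TCell d (n * L ^ K) × Template d M}
  {p p' : Addr D → TCell d (n * L ^ K) × Template d M} {Z : Gen PEv}

/-- **`OK` IS READ OFF THE BIRTHS' READING AND THE ROOT VALUE.** [folklore] -/
theorem ok_congr (hb : bread c₀ Z p = bread c₀ Z p') (hr : evalA c₀ p (rootAddr Z) = evalA c₀ p' (rootAddr Z)) :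
    OK n L K lv c₀ p Z ↔ OK n L K lv c₀ p' Z := by
  have hI := image_births_addrTag_eq_of_bread_eq c₀ hb
  have h1 := forall_congr_of_image_eq hI
    fun x => x.2.2.1.card ≤ tcap d x.1.fat ∧ IsScale L (lv x.1.step) x.2.1
  unfold OK
  rw [hr]
  exact and_congr_left' h1

/-- **THE CORE ZONE IS READ OFF THE BIRTHS' READING.** [folklore] -/
theorem coreZoneD_regOf_congr (hb : bread c₀ Z p = bread c₀ Z p') (t : ℕ) :
    coreZoneD Prod.snd L lv (regOf n L K lv c₀ p) t (addrTag [] Z) =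
      coreZoneD Prod.snd L lv (regOf n L K lv c₀ p') t (addrTag [] Z) := by
  have hI := image_births_addrTag_eq_of_bread_eq c₀ hb
  unfold coreZoneD regOf
  exact biUnion_congr_of_image_eq hI fun x =>
    if x.1.step ≤ t then
      blocks (L ^ (lv t - lv x.1.step))
        (redZone (n * L ^ (K - lv x.1.step)) (translate x.2.2 (anchorZ L lv x.2.1 x.1.step)))
    else ∅

/-- **THE INSTANCE's ZONE READS THE BIRTHS AND THE ROOT CELL ONLY**: two placements of `Z` with the same births'
reading and the same root value have the same `zoneP` at every step. [folklore] -/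
theorem zoneP_congr (hb : bread c₀ Z p = bread c₀ Z p') (hr : evalA c₀ p (rootAddr Z) = evalA c₀ p' (rootAddr Z))
    (t : ℕ) : zoneP n L K lv c c₀ t Z p = zoneP n L K lv c c₀ t Z p' := by
  have hreg : regZoneD Prod.snd n L K lv c (regOf n L K lv c₀ p) t (addrTag [] Z) =
      regZoneD Prod.snd n L K lv c (regOf n L K lv c₀ p') t (addrTag [] Z) := by
    unfold regZoneD
    rw [coreZoneD_regOf_congr hb t]
  unfold zoneP
  rw [hreg]
  simp only [ok_congr hb hr]

variable (n L K lv c c₀) in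
/-- **THE HYPOTHESIS `hzone` OF `HistoryJoinsRearrange.exists_rearranged_cadm` HOLDS FOR `zoneP`** (in its exact shape;
the two junk hypotheses are not even needed). [folklore] -/
theorem hzone_zoneP (t : ℕ) (Z : Gen PEv) (p p' : Addr D → TCell d (n * L ^ K) × Template d M)
    (_hJ : Junk Z c₀ p) (_hJ' : Junk Z c₀ p') (hb : bread c₀ Z p = bread c₀ Z p')
    (hr : evalA c₀ p (rootAddr Z) = evalA c₀ p' (rootAddr Z)) :
    zoneP n L K lv c c₀ t Z p = zoneP n L K lv c c₀ t Z p' :=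
  zoneP_congr hb hr t

/-- **COROLLARY: THE RECURSION FOR THE INSTANCE's ZONE.**  For `zone := zoneP n L K lv c c₀` and an injective root
read-out `ρ`, every junk placement of a tree of depth `≤ D` with the order-free datum `PhysTop` at every join has a
ρ-tie-broken rearrangement with the same births' reading in `S (zoneP …) ρ c₀ st Z (root value)`. [folklore] -/
theorem exists_rearranged_mem_S_zoneP {R : Type*} [LinearOrder R] {ρ : (Addr D → TCell d (n * L ^ K) × Template d M) → R}
    (hρ : Function.Injective ρ) (st : PEv → ℕ) {G : Gen PEv} {P : Addr D → TCell d (n * L ^ K) × Template d M}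
    (hD : ∀ a ∈ baddr G, a.length ≤ D) (hJ : Junk G c₀ P)
    (hA : AllJoins c₀ st (PhysTop c₀ st (zoneP n L K lv c c₀)) G P) :
    ∃ P', bread c₀ G P' = bread c₀ G P ∧ P' ∈ S (zoneP n L K lv c c₀) ρ c₀ st G (evalA c₀ P (rootAddr G)) :=
  exists_rearranged_mem_S (hzone_zoneP n L K lv c c₀) hρ hD hJ hA

end Zone

end

end Summit.QuantumFields.BalabanUV.T4Continuum.HistoryJoinsPlacedZoneRead
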